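import Literature.NumberTheory.Sieve.HeathBrownCubicApproxUE3
import HarnessLib

/-!
# Heath-Brown's Lemma 3.7 from Lemma 7.1, V: the per-`n` bound `|U₁^(n) − Û^(n)|` for a general family

Pure-proof file (no definitions) in the deduction of **Lemma 3.7 from the corrected Lemma 7.1** of
D. R. Heath-Brown, *Primes represented by `x³ + 2y³`*, Acta Math. 186 (2001), 1–84, §7 pp. 42–47
(decomposition of **parity.S18**, `Literature.NumberTheory.Sieve.setOf_prime_cube_add_two_mul_cube_infinite`).
`U_bound_of_h7` combines the raw inequality `U_abs_sub_le` (`HeathBrownCubicApproxUCore`) with the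
Lemma 7.1 estimates of (E2), (E5) (`HeathBrownCubicApproxUWeights`) and (E3)
(`HeathBrownCubicApproxUE3`): for `n ≥ 1` and a general family,
`|U₁^(n) − Û^(n)| ≤ E1 + E3ii + E4 + (C₇M/(τ log X))·[5B_w e_n + L_t B_w e_{n−1} + L_t B_ξ (e_n + 20) + δ e_{n+1}] + (66 + 3δ) log X · C₇ Err`
with `w(p) = c_K(p)/p` on `P0 = {X^τ ≤ p < X^{1−τ}}`, `L_t = ∑_{P0} w`, `e_j` its elementary symmetric
sums, `B_w = 2((n+1)ξ log X + log 2 + C₁)/(τ log X)`, `B_ξ = 2(ξ log X + C₁)/(τ log X)`,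
`δ = (1 + 1/μ)^{n+1} − 1` (`1 ≤ μ ≤ τξ^{-1}`), and the three family-dependent raw terms E1 (non-good
chain indices), E3ii (Buchstab primes of degree `≥ 2` or repeated norm), E4 (square-free defect) —
all zero or polynomially small for `𝒜^(K)`, `ℬ^(K)` (next files). With `e_j ≤ L_t^j/j!` and
`L_t ≤ log(2/τ) + O(1/(τ log X))` this is `≪ ξτ^{-2}(log τ^{-1})^{n+O(1)}/n! · M/log X`, pp. 42–45.

## References

* D. R. Heath-Brown, *Primes represented by `x³ + 2y³`*, Acta Math. 186 (2001), 1–84: §7 pp. 42–45.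
  [cite: HeathBrownActa2001, §7 pp. 42–45]

## Mathlib / tree search

Tree: `HeathBrownCubicApproxUCore` (`U_abs_sub_le`, `sum_unmatched_good_le`), `HeathBrownCubicApproxUWeights`
(`sum_good_family_le`, `E2_pattern_weight_le`, `E5_le`), `HeathBrownCubicApproxUE3` (`E3_le`).
-/

noncomputable section

open Polynomial NumberField Finset Filter Topology Asymptotics
open scoped nonZeroDivisors

namespace Literature.NumberTheory.Sieve.CubicSieve

open LFunctions.CubeRootTwoField CubicPrimes
open Literature.NumberTheory.LFunctions (idealNormCount)

section UBound

variable {ι : Type*} (E : Finset ι) (I : ι → Ideal (𝓞 K)) {X τ CN C₇ C₁ M Err : ℝ} {n : ℕ}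

open scoped Classical in
/-- **The per-`n` bound for `|U₁^(n) − Û^(n)|`, general family** (`n ≥ 1`; Lemma 7.1 as hypothesis
`h7`, main term `M`, error `Err`; sharp Mertens windows `hwin`): with `c = C₇M/(τ log X)`,
`w(p) = c_K(p)/p`, `P0 = {X^τ ≤ p < X^{1−τ}}`, `L_t = ∑_{P0} w`, `e_j` the elementary symmetric sums of
`w` over `P0`, `B_w = 2((n+1)ξ log X + log 2 + C₁)/(τ log X)` and `δ = (1+1/μ)^{n+1} − 1`,
`|U₁^(n) − Û^(n)| ≤ E1 + E3ii + E4 + c·[5B_w e_n + L_t B_w e_{n−1} + L_t B_ξ (e_n + 20) + δ e_{n+1}] + (66 + 3δ) log X · C₇ Err`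
(`B_ξ = 2(ξ log X + C₁)/(τ log X)`),
where E1 (non-good chain indices), E3ii (Buchstab primes of degree `≥ 2` / repeated norm) and E4
(square-free defect) are the raw family-dependent terms. This is pp. 42–45 for one `n`.
[cite: HeathBrownActa2001, §7 pp. 42–45] -/
theorem U_bound_of_h7 (hC₁ : 0 ≤ C₁)
    (hwin : ∀ (lo hi : ℝ) (T : Finset ℕ), 2 ≤ lo → lo ≤ hi →
      (∀ p ∈ T, p.Prime ∧ lo < (p : ℝ) ∧ (p : ℝ) ≤ hi) →
      ∑ p ∈ T, (idealNormCount K p : ℝ) * (p : ℝ)⁻¹ ≤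
        Real.log (Real.log hi / Real.log lo) + C₁ / Real.log lo)
    (hX : (2 : ℝ) ^ 15 ≤ X) (hτ : 0 < τ) (hτ1 : τ ≤ 1 / 40) (hXτ : 4 ≤ X ^ τ)
    (hXτ2 : 2 * X ^ τ ≤ X ^ (1 / 2 : ℝ)) (hCN : CN < X ^ (3 * τ))
    (hE : ∀ i ∈ E, I i ≠ ⊥ ∧ (Ideal.absNorm (I i) : ℝ) ≤ CN * X ^ 3)
    (hC₇ : 0 ≤ C₇) (hM : 0 ≤ M) (hErr : 0 ≤ Err)
    (h7 : ∀ (N z : ℝ) (𝒬 : Finset ℕ), X ^ τ ≤ z → 0 < N → N ≤ X ^ (2 - 2 * τ) →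
        (∀ q ∈ 𝒬, Squarefree q ∧ N < q ∧ (q : ℝ) ≤ 2 * N) →
        ∑ Q ∈ normIn 𝒬, (famSifted E I Q z : ℝ) ≤
          C₇ * (M / Real.log (min z (X ^ (2 - τ) / N)) *
            ∑ Q ∈ normIn 𝒬, ((Ideal.absNorm Q : ℕ) : ℝ)⁻¹ + Err))
    (hn : 1 ≤ n) {μ : ℕ} (hμ : 1 ≤ μ) (hμle : (μ : ℝ) ≤ τ / hbXi τ) :
    |(U1piece E I X τ n : ℝ) - Uhat X τ E I n| ≤
      ∑ t ∈ (Upairs X τ n).filter (fun t => ¬ UGood t), (famCount E I (uIdeal t) : ℝ) +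
      ∑ b ∈ (mIndexU τ n).sigma (fun m => Fintype.piFinset fun i => Jprimes X τ (m i)),
        ∑ Q ∈ ((idealsLE (Ideal.absNorm (b.2 (Fin.last n)))).filter
            (fun Q => Q.IsPrime ∧ Q ≠ ⊥ ∧ X ^ ((b.1 (Fin.last n) : ℝ) * hbXi τ) ≤ (Ideal.absNorm Q : ℝ) ∧
              PrimeLT Q (b.2 (Fin.last n)))).filter
            (fun Q => ¬ ((Ideal.absNorm Q).Prime ∧ ∀ j, Ideal.absNorm Q ≠ Ideal.absNorm (b.2 j))),
          (famCount E I (Q * ∏ j, b.2 j) : ℝ) +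
      ∑ b ∈ (mIndexU τ n).sigma (fun m => Fintype.piFinset fun i => Jprimes X τ (m i)),
        (#{i ∈ E | (∏ j, b.2 j) ∣ I i ∧ IsRough (X ^ ((b.1 (Fin.last n) : ℝ) * hbXi τ)) (I i) ∧
            ¬ Squarefree (Ideal.absNorm (I i) / Ideal.absNorm (∏ j, b.2 j))} : ℝ) +
      C₇ * (M / (τ * Real.log X)) *
        (5 * (2 * ((n + 1) * hbXi τ * Real.log X + Real.log 2 + C₁) / (τ * Real.log X)) *
            (∑ σ' ∈ ((range (⌊X ^ (1 - τ)⌋₊ + 1)).filter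
                (fun p : ℕ => p.Prime ∧ X ^ τ ≤ (p : ℝ) ∧ (p : ℝ) < X ^ (1 - τ))).powersetCard n,
              ∏ p ∈ σ', (idealNormCount K p : ℝ) * (p : ℝ)⁻¹) +
          (∑ p ∈ (range (⌊X ^ (1 - τ)⌋₊ + 1)).filter
              (fun p : ℕ => p.Prime ∧ X ^ τ ≤ (p : ℝ) ∧ (p : ℝ) < X ^ (1 - τ)), (idealNormCount K p : ℝ) * (p : ℝ)⁻¹) *
            (2 * ((n + 1) * hbXi τ * Real.log X + Real.log 2 + C₁) / (τ * Real.log X)) *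
            (∑ σ' ∈ ((range (⌊X ^ (1 - τ)⌋₊ + 1)).filter
                (fun p : ℕ => p.Prime ∧ X ^ τ ≤ (p : ℝ) ∧ (p : ℝ) < X ^ (1 - τ))).powersetCard (n - 1),
              ∏ p ∈ σ', (idealNormCount K p : ℝ) * (p : ℝ)⁻¹) +
          (∑ p ∈ (range (⌊X ^ (1 - τ)⌋₊ + 1)).filter
              (fun p : ℕ => p.Prime ∧ X ^ τ ≤ (p : ℝ) ∧ (p : ℝ) < X ^ (1 - τ)), (idealNormCount K p : ℝ) * (p : ℝ)⁻¹) *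
            (2 * (hbXi τ * Real.log X + C₁) / (τ * Real.log X)) *
            (∑ σ' ∈ ((range (⌊X ^ (1 - τ)⌋₊ + 1)).filter
                (fun p : ℕ => p.Prime ∧ X ^ τ ≤ (p : ℝ) ∧ (p : ℝ) < X ^ (1 - τ))).powersetCard n,
              ∏ p ∈ σ', (idealNormCount K p : ℝ) * (p : ℝ)⁻¹ + 20) +
          ((1 + 1 / (μ : ℝ)) ^ (n + 1) - 1) *
            (∑ σ' ∈ ((range (⌊X ^ (1 - τ)⌋₊ + 1)).filter
                (fun p : ℕ => p.Prime ∧ X ^ τ ≤ (p : ℝ) ∧ (p : ℝ) < X ^ (1 - τ))).powersetCard (n + 1),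
              ∏ p ∈ σ', (idealNormCount K p : ℝ) * (p : ℝ)⁻¹)) +
      (66 + 3 * ((1 + 1 / (μ : ℝ)) ^ (n + 1) - 1)) * Real.log X * (C₇ * Err) := by
  classical
  have hX1 : 1 < X := lt_of_lt_of_le (by norm_num) hX
  have hX0 : 0 < X := by linarith
  have hτ1' : τ ≤ 1 := by linarith
  have hτ8 : τ ≤ 1 / 8 := by linarith
  have hL : 0 < Real.log X := Real.log_pos hX1
  have hξ := hbXi_pos hτ
  have h0 : ∀ i ∈ E, I i ≠ ⊥ := fun i hi => (hE i hi).1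
  -- the raw inequality
  have hraw := U_abs_sub_le E I (n := n) hX1 hτ hτ1' h0 hμ hμle
  -- (E2)
  have hE2a := sum_unmatched_good_le (X := X) (τ := τ) (n := n) hX1 hτ
    (fun t => (famSifted E I (uIdeal t) (X ^ τ) : ℝ)) (fun t => Nat.cast_nonneg _)
  have hE2b := sum_good_family_le E I hX hτ hτ8 hXτ2 hC₇ hM hErr h7 (n := n)
    ((Upairs X τ n).filter (fun t => UGood t ∧
          (Ideal.absNorm (uIdeal t) : ℝ) ≤ X ^ (3 / 2 - τ) ∧
          ((∃ Q ∈ insert t.2 t.1, (Ideal.absNorm Q : ℝ) < X ^ (τ + hbXi τ)) ∨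
           (∃ Q ∈ insert t.2 t.1, X ^ (1 - τ - hbXi τ) ≤ (Ideal.absNorm Q : ℝ)) ∨
           (X ^ (1 + τ - n * hbXi τ) < (Ideal.absNorm (∏ P ∈ t.1, P) : ℝ)) ∨
           ((Ideal.absNorm (uIdeal t) : ℝ) < X ^ (1 + τ + (n + 1) * hbXi τ)) ∨
           (∃ Q ∈ insert t.2 t.1, ∃ Q' ∈ insert t.2 t.1, Ideal.absNorm Q < Ideal.absNorm Q' ∧
              (Ideal.absNorm Q' : ℝ) < Ideal.absNorm Q * X ^ hbXi τ) ∨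
           (X ^ (3 / 2 - τ - (n + 1) * hbXi τ) < (Ideal.absNorm (uIdeal t) : ℝ)))))
    (fun t ht => by
      have h := mem_filter.mp ht
      exact ⟨h.1, h.2.1, h.2.2.1⟩)
  have hE2c := E2_pattern_weight_le (X := X) (τ := τ) (n := n) hC₁ hwin hX1 hτ hXτ hn
  -- (E3)
  have hE3 := E3_le E I hC₁ hwin hX hτ hτ1 hXτ hCN hE hC₇ hM hErr h7 (n := n)
  -- (E5)
  have hE5 := E5_le E I hX hτ hτ8 hXτ2 hC₇ hM hErr h7 (n := n)
  -- non-negativity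
  have hδ0 : 0 ≤ (1 + 1 / (μ : ℝ)) ^ (n + 1) - 1 := by
    have h1 : (1 : ℝ) ≤ 1 + 1 / (μ : ℝ) := by
      have : (0 : ℝ) ≤ 1 / (μ : ℝ) := by positivity
      linarith
    have : (1 : ℝ) ≤ (1 + 1 / (μ : ℝ)) ^ (n + 1) := one_le_pow₀ h1
    linarith
  have hc0 : 0 ≤ C₇ * (M / (τ * Real.log X)) := by positivity
  have hE5' := mul_le_mul_of_nonneg_left hE5 hδ0
  have hE2bc := mul_le_mul_of_nonneg_left hE2c hc0
  linarith [hraw, hE2a, hE2b, hE3, hE5', hE2bc]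

end UBound

end Literature.NumberTheory.Sieve.CubicSieve

end
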